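import Mathlib
import Literature.Computability.AlgebraicComplexity.StandardFamilies
import HarnessLib

/-!
# The fermionic pencil (Vere-Jones `α`-determinant / fermionant), the cycle-counting determinant and the cycle jets

Topic `Literature/Computability/AlgebraicComplexity` (definition item `cycleJetPoly`, route
`ValiantsHypothesis/FermionicJet`, whose statements inline the sums below).

For a finite index type `n` and a commutative ring `k`:

* `Equiv.Perm.numCycles σ` — the number of cycles of `σ` INCLUDING fixed points,
  `card (cycleType σ) + #{i | σ i = i}` (verbatim the expression inlined by the route), with
  `numCycles_one = card n`, `numCycles_le_card`, the cycle formula for the sign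
  `sign σ = (-1)^(card n - numCycles σ)` (`sign_eq_neg_one_pow_card_sub_numCycles`), and
  `numCycles = 1` for a full cycle;
* `fermionicPencil n k t = ∑_σ sign σ · t^{c(σ)} ∏ᵢ X_{σ i, i}` — the one-parameter pencil
  interpolating determinant and permanent: Vere-Jones' `α`-determinant / the fermionant `Ferm^t`
  of Chandrasekharan–Wiebe as used by Mertens–Moore and de Rugy-Altherre (convention `∏ X_{σ i, i}`,
  as the tree's `detPoly`), with `fermionicPencil 1 = detPoly` and
  `fermionicPencil (-1) = C ((-1)^{card n}) * perPoly` PROVED, and the variable-`t` version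
  `fermionicPencilVar` in `MvPolynomial (Option (n × n)) k`;
* `cdetPoly n k = ∑_σ sign σ · c(σ) ∏ᵢ X_{σ i, i}` — the cycle-counting determinant, and
  `cycleJetPoly n k j = ∑_σ sign σ · binom(c(σ), j) ∏ᵢ X_{σ i, i}` — the `j`-th Taylor coefficient of
  the pencil at `t = 1`, with `cycleJetPoly 0 = detPoly`, `cycleJetPoly 1 = cdetPoly` PROVED, and the
  square-free-monomial form `cycleJetPoly_eq_sum_monomial` (the shape of the barrier file's
  `permSum`, `Literature.Barriers.ValiantsHypothesis.PartialDerivativesDetPerm`).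

The coefficient casts follow the route's inline terms literally
(`C ((((sign σ : ℤ) * (… : ℕ)) : ℤ) : k)`), so those restate by `rfl`.

## References

* D. Vere-Jones, *A generalization of permanents and determinants*, Linear Algebra Appl. 111
  (1988).
* S. Mertens, C. Moore, *The complexity of the fermionant and immanants of constant width*,
  Theory Comput. 9 (2013), arXiv:1110.1821. [MertensMoore2013]
* N. de Rugy-Altherre, *Determinant versus permanent: salvation via generalization?*, CiE 2013,
  arXiv:1309.2156, §3. [DeRugyAltherre2013]
* A. Björklund, P. Kaski, R. Williams, *Generalized Kakeya sets … and faster fermionants*,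
  Algorithmica (2019), §1.2. [BjorklundKaskiWilliams2018]
-/

noncomputable section

open MvPolynomial Finset

/-! ### Number of cycles of a permutation, fixed points included -/

namespace Equiv.Perm

variable {n : Type*} [Fintype n] [DecidableEq n]

/-- The number of cycles of a permutation of a finite type, COUNTING FIXED POINTS as cycles of
length one: `card (cycleType σ) + #{i | σ i = i}` (so the identity of `n` has `card n` cycles and a
full cycle has one). A deliberate dot-notation extension of Mathlib's `Equiv.Perm` namespace,
verbatim the expression inlined by route `ValiantsHypothesis/FermionicJet`. [folklore] -/
def numCycles (σ : Equiv.Perm n) : ℕ :=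
  Multiset.card σ.cycleType + (Finset.univ.filter fun i => σ i = i).card

/-- Unfolding of `numCycles`. [folklore] -/
theorem numCycles_def (σ : Equiv.Perm n) :
    σ.numCycles = Multiset.card σ.cycleType + (Finset.univ.filter fun i => σ i = i).card :=
  rfl

/-- The fixed points are the complement of the support. [folklore] -/
theorem filter_eq_self_eq_compl_support (σ : Equiv.Perm n) :
    (Finset.univ.filter fun i => σ i = i) = σ.supportᶜ := by
  ext i
  simp [Equiv.Perm.mem_support]

/-- The number of fixed points is `card n - #support`. [folklore] -/
theorem card_filter_eq_self (σ : Equiv.Perm n) :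
    (Finset.univ.filter fun i => σ i = i).card = Fintype.card n - σ.support.card := by
  rw [filter_eq_self_eq_compl_support, Finset.card_compl]

/-- `numCycles σ = card (cycleType σ) + (card n - #support σ)`. [folklore] -/
theorem numCycles_eq (σ : Equiv.Perm n) :
    σ.numCycles = Multiset.card σ.cycleType + (Fintype.card n - σ.support.card) := by
  rw [numCycles, card_filter_eq_self]

/-- The identity has `card n` cycles (all fixed points). [folklore] -/
@[simp] theorem numCycles_one : (1 : Equiv.Perm n).numCycles = Fintype.card n := by
  simp [numCycles]

/-- There are at most as many nontrivial cycles as moved points (each cycle has length `≥ 2`).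
[folklore] -/
theorem card_cycleType_le_card_support (σ : Equiv.Perm n) :
    Multiset.card σ.cycleType ≤ σ.support.card := by
  rw [← Equiv.Perm.sum_cycleType]
  calc Multiset.card σ.cycleType = (σ.cycleType.map fun _ => 1).sum := by simp
    _ ≤ (σ.cycleType.map id).sum := by
        refine Multiset.sum_map_le_sum_map _ _ fun l hl => ?_
        exact le_trans (by norm_num) (Equiv.Perm.two_le_of_mem_cycleType hl)
    _ = σ.cycleType.sum := by rw [Multiset.map_id]

/-- `numCycles σ ≤ card n`. [folklore] -/
theorem numCycles_le_card (σ : Equiv.Perm n) : σ.numCycles ≤ Fintype.card n := by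
  rw [numCycles_eq]
  have h1 := card_cycleType_le_card_support σ
  have h2 : σ.support.card ≤ Fintype.card n := Finset.card_le_univ _
  omega

/-- `card n - numCycles σ = #support σ - card (cycleType σ)` (the number of "transpositions" of
`σ`). [folklore] -/
theorem card_sub_numCycles (σ : Equiv.Perm n) :
    Fintype.card n - σ.numCycles = σ.support.card - Multiset.card σ.cycleType := by
  rw [numCycles_eq]
  have h1 := card_cycleType_le_card_support σ
  have h2 : σ.support.card ≤ Fintype.card n := Finset.card_le_univ _
  omega

/-- There are at most as many nontrivial cycles as the total length of the cycles. [folklore] -/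
theorem card_cycleType_le_sum (σ : Equiv.Perm n) :
    Multiset.card σ.cycleType ≤ σ.cycleType.sum := by
  rw [Equiv.Perm.sum_cycleType]
  exact card_cycleType_le_card_support σ

/-- **Cycle formula for the sign** (integer form): `sign σ = (-1)^(card n - numCycles σ)` in `ℤ`
(a cycle of length `l` has sign `(-1)^(l-1)`; from Mathlib's `Equiv.Perm.sign_of_cycleType`).
Stated on `(sign σ : ℤ)` — the form used by the route — to stay clear of the two (defeq but
syntactically different) power instances on `ℤˣ`. [folklore] -/
theorem sign_eq_neg_one_pow_card_sub_numCycles (σ : Equiv.Perm n) :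
    ((Equiv.Perm.sign σ : ℤˣ) : ℤ) = (-1 : ℤ) ^ (Fintype.card n - σ.numCycles) := by
  rw [card_sub_numCycles, ← Equiv.Perm.sum_cycleType, Equiv.Perm.sign_of_cycleType,
    Units.val_pow_eq_pow_val, Units.val_neg, Units.val_one]
  obtain ⟨d, hd⟩ := Nat.exists_eq_add_of_le (card_cycleType_le_sum σ)
  rw [hd, Nat.add_sub_cancel_left,
    show Multiset.card σ.cycleType + d + Multiset.card σ.cycleType = d + 2 * Multiset.card σ.cycleType
      by ring,
    pow_add, pow_mul, neg_one_sq, one_pow, mul_one]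

/-- `sign σ · (-1)^{numCycles σ} = (-1)^{card n}` — the identity behind
`fermionicPencil (-1) = (-1)^{card n} · per`. [folklore] -/
theorem sign_mul_neg_one_pow_numCycles (σ : Equiv.Perm n) :
    (Equiv.Perm.sign σ : ℤ) * (-1) ^ σ.numCycles = (-1) ^ Fintype.card n := by
  rw [sign_eq_neg_one_pow_card_sub_numCycles, ← pow_add, Nat.sub_add_cancel (numCycles_le_card σ)]

/-- A full cycle (`cycleType = {card n}`) has exactly one cycle. [folklore] -/
theorem numCycles_of_cycleType_eq (σ : Equiv.Perm n) (h : σ.cycleType = {Fintype.card n}) :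
    σ.numCycles = 1 := by
  have hsupp : σ.support.card = Fintype.card n := by
    rw [← Equiv.Perm.sum_cycleType, h, Multiset.sum_singleton]
  rw [numCycles_eq, h, Multiset.card_singleton, hsupp, Nat.sub_self]

end Equiv.Perm

/-! ### The pencil, the cycle-counting determinant and the cycle jets -/

namespace Literature.Computability.AlgebraicComplexity

universe u

variable (n : Type*) [Fintype n] [DecidableEq n] (k : Type u) [CommRing k]

/-- **The fermionic pencil** `Ferm^t_n = ∑_σ sign σ · t^{c(σ)} ∏ᵢ X_{σ i, i}`, `c(σ)` the number of
cycles including fixed points (Vere-Jones' `α`-determinant with `α t`-weighting of cycles; the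
fermionant of Mertens–Moore / de Rugy-Altherre §3; Björklund–Kaski–Williams §1.2). At `t = 1` it is
the determinant, at `t = -1` it is `(-1)^{card n}` times the permanent.
[cite: DeRugyAltherre2013, §3] -/
def fermionicPencil (t : k) : MvPolynomial (n × n) k :=
  ∑ σ : Equiv.Perm n, C (((Equiv.Perm.sign σ : ℤ) : k) * t ^ σ.numCycles) * ∏ i, X (σ i, i)

/-- The pencil with `t` an indeterminate: `∑_σ sign σ · T^{c(σ)} ∏ᵢ X_{σ i, i}` in
`k[T, X_{ij}] = MvPolynomial (Option (n × n)) k` (`T = X none`, `X_{ij} = X (some (i, j))`).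
[cite: DeRugyAltherre2013, §3] -/
def fermionicPencilVar : MvPolynomial (Option (n × n)) k :=
  ∑ σ : Equiv.Perm n, C ((Equiv.Perm.sign σ : ℤ) : k) * X none ^ σ.numCycles * ∏ i, X (some (σ i, i))

/-- **The cycle-counting determinant** `cdet_n = ∑_σ sign σ · c(σ) ∏ᵢ X_{σ i, i}` (the derivative of
the pencil at `t = 1`; verbatim the route's inline term). [cite: DeRugyAltherre2013, §3] -/
def cdetPoly : MvPolynomial (n × n) k :=
  ∑ σ : Equiv.Perm n,
    C ((((Equiv.Perm.sign σ : ℤ) * ((σ.numCycles : ℕ) : ℤ)) : ℤ) : k) * ∏ i, X (σ i, i)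

/-- **The cycle jets** `J_j = ∑_σ sign σ · binom(c(σ), j) ∏ᵢ X_{σ i, i}`: the `j`-th Taylor
coefficient of the pencil `t ↦ Ferm^t` at `t = 1` (`t^c = ∑_j binom(c, j) (t - 1)^j`); verbatim
the route's inline term. [cite: DeRugyAltherre2013, §3] -/
def cycleJetPoly (j : ℕ) : MvPolynomial (n × n) k :=
  ∑ σ : Equiv.Perm n,
    C ((((Equiv.Perm.sign σ : ℤ) * (Nat.choose σ.numCycles j : ℕ)) : ℤ) : k) * ∏ i, X (σ i, i)

variable {n k}

/-- The generic determinant as a signed permutation sum with `C`-coefficients: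
`detPoly = ∑_σ C(sign σ) ∏ᵢ X_{σ i, i}`. [folklore] -/
theorem detPoly_eq_sum : detPoly n k = ∑ σ : Equiv.Perm n, C ((Equiv.Perm.sign σ : ℤ) : k) * ∏ i, X (σ i, i) := by
  rw [detPoly, Matrix.det_apply]
  refine Finset.sum_congr rfl fun σ _ => ?_
  rw [Units.smul_def, ← Int.cast_smul_eq_zsmul k, MvPolynomial.smul_eq_C_mul]
  rfl

/-- The generic permanent as a permutation sum: `perPoly = ∑_σ ∏ᵢ X_{σ i, i}`. [folklore] -/
theorem perPoly_eq_sum : perPoly n k = ∑ σ : Equiv.Perm n, ∏ i, (X (σ i, i) : MvPolynomial (n × n) k) := by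
  rw [perPoly, Matrix.permanent]
  rfl

/-- **`Ferm^1 = det`.** [cite: DeRugyAltherre2013, §3] -/
theorem fermionicPencil_one : fermionicPencil n k 1 = detPoly n k := by
  rw [detPoly_eq_sum, fermionicPencil]
  simp only [one_pow, mul_one]

/-- **`Ferm^{-1} = (-1)^{card n} · per`.** [cite: DeRugyAltherre2013, §3] -/
theorem fermionicPencil_neg_one :
    fermionicPencil n k (-1) = C ((-1) ^ Fintype.card n) * perPoly n k := by
  rw [perPoly_eq_sum, fermionicPencil, Finset.mul_sum]
  refine Finset.sum_congr rfl fun σ _ => ?_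
  congr 2
  have h := congrArg (Int.cast : ℤ → k) (Equiv.Perm.sign_mul_neg_one_pow_numCycles σ)
  push_cast at h
  exact h

/-- The `0`-th jet is the determinant (`binom(c, 0) = 1`). [cite: DeRugyAltherre2013, §3] -/
theorem cycleJetPoly_zero : cycleJetPoly n k 0 = detPoly n k := by
  rw [detPoly_eq_sum, cycleJetPoly]
  simp only [Nat.choose_zero_right, Nat.cast_one, mul_one]

/-- The first jet is the cycle-counting determinant (`binom(c, 1) = c`). [cite: DeRugyAltherre2013, §3] -/
theorem cycleJetPoly_one : cycleJetPoly n k 1 = cdetPoly n k := by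
  rw [cycleJetPoly, cdetPoly]
  simp only [Nat.choose_one_right]

omit [DecidableEq n] in
/-- `∏ᵢ X_{σ i, i}` is the square-free monomial on the graph of `σ`. [folklore] -/
theorem prod_X_perm_eq_monomial (σ : Equiv.Perm n) :
    ∏ i, (X (σ i, i) : MvPolynomial (n × n) k) = monomial (∑ i, Finsupp.single (σ i, i) 1) 1 := by
  rw [monomial_sum_one]
  rfl

/-- The cycle jets as a sum of square-free monomials (the shape of `permSum` in the barrier file
`Literature.Barriers.ValiantsHypothesis.PartialDerivativesDetPerm`, whose `sqfree (offGraph π ∅)` is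
`∑ i, Finsupp.single (π i, i) 1`). [folklore] -/
theorem cycleJetPoly_eq_sum_monomial (j : ℕ) :
    cycleJetPoly n k j = ∑ σ : Equiv.Perm n,
      monomial (∑ i, Finsupp.single (σ i, i) 1)
        ((((Equiv.Perm.sign σ : ℤ) * (Nat.choose σ.numCycles j : ℕ)) : ℤ) : k) := by
  rw [cycleJetPoly]
  refine Finset.sum_congr rfl fun σ _ => ?_
  rw [prod_X_perm_eq_monomial, C_mul_monomial, mul_one]

end Literature.Computability.AlgebraicComplexity
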